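/-
COR-CM (cell pub-hodgecm2, stage 2 of the Hodge ladder) — count-neutral KERNEL SCHEMA «INT-2 / T1, degree-local form»
(seat prover-pub-hodgecm2-b23-g30-0, binder prover b23, gen 30; claim INT2-SCHEMA, HOME/lit/LIT-STATUS.md 2026-08-21T12:38:00Z,
HOME/INBOX.md l.3696).  The path and the statement are the ones typed by the stage-2 lead in hodge-director/B01-SIZE.md §4
«T1 TYPED» and tabled by the director in hodge-director/WEEKEND-PLAN.md lane (1) («int2-typist», deliverable
`CorCM/FacePeriodsFieldLocal.lean`) and lane (2) («FIELD CLOSURE»).  Theorems only; no definition, no named fact, nothing asserted;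
composition BY NAME of tree theorems of seats b07 (`CorCM/PeriodCharacterTransport.lean`, `CorCM/FacePeriodWitnesses.lean`),
b07/b24 (`CorCM/Model/WeilFaceAlgebraicOfWeilLineClasses.lean`, `CorCM/Model/CMSliceOfWeilFaces.lean`) and own-b01
(`CorCM/B01/ThetaRealisationSocket.lean`); nothing of theirs is restated.  NOT an E term, NOT a display of record, no BINDER-OWNERS
row; `Interfaces.lean` (C1) and `Assembly/ModelChain*.lean` untouched.

HONEST FRAMING (COORDINATOR RULING — HODGE FRAMING CORRECTION, 2026-08-21T11:55:35Z): `HC_CM` (the Hodge conjecture for ALL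
complex abelian varieties of CM type) is NOT proved, here or anywhere in the tree.  This file proves NO face period.  It records the
DEGREE-LOCAL honest form of the chain: what the face periods of ONE Galois CM field `F` buy — the Hodge conjecture for the abelian
varieties dominated by products of CM abelian varieties with CM types of CM subfields of THAT `F` — and nothing more.
-/
import Summits.HodgeConjecture.CorCM.FacePeriodWitnesses
import Summits.HodgeConjecture.CorCM.Model.CMSliceOfWeilFaces
import Summits.HodgeConjecture.CorCM.B01.ThetaRealisationSocket
import HarnessLib

/-!
# Face periods of ONE Galois CM field `F` ⟹ the Hodge conjecture for the `F`-generated CM slice (degree-local schema)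

The global chain of this cell, `hc_cm_closed_of_exists_facePeriod` (`CorCM/FacePeriodWitnesses.lean` :189), reads

  (∀ Galois CM `F`, `6 ≤ [F:ℚ]`, ∀ face `f` of `F`, ∃ admissible `ι₁`, ∃ `V`, ∃ `σ`, `U_rec.PeriodNV ι₁ V F f.psi σ`) ⟹ `HC_CM`.

Every arrow in it except the last (rfwf v3 Lemma 8.2, `Universe.Lemma81`: reduction of an arbitrary CM abelian variety to
products `∏_j A_{(F,Θ_j)}` over ONE sufficiently large Galois CM field) is LOCAL IN THE FIELD, and the first arrow is even LOCAL IN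
THE FACE:

* (face-local) a period witness for ONE face `f` of `F` ⟹ the Weil line `W_F(P(f)) ⊂ H⁴(P(f), ℚ)` of the corner product
  `P(f) = ∏_{i<4} A_{(F, ψ_i(f))}` consists of algebraic classes (`U.WeilFaceAlgebraic F f`): transport of the eigen-embedding
  `σ ↦ ι₁` (`Universe.periodNV_of_periodNV_of_forall_mem`, b07) and the surface criterion rfwf Prop. 2.2 on `S = P_Γ(V)`
  (`Universe.surfaceCriterion_holds`, a kernel theorem over the model facts) — §1 `Universe.weilFaceAlgebraic_of_exists_periodNV`;
* (field-local) all face lines of `F` algebraic ⟹ `U.HC (U.cmProd F Θ)` for every finite family `Θ` of CM types of `F`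
  (`Universe.FaceReduction` = Pohlmann's span theorem + [QW8] Thm 2.5, kernel: `StubTree.faceReduction_holds`,
  `Model.universeOf_faceReduction_of_riemann`) ⟹ on the tree's abelian varieties: `HodgeConjectureFor` for `∏_j A_{(F,Θ_j)}`
  (`Domination.cmProdAV`) and for every complex abelian variety DOMINATED by a finite product of realisations of CM types of CM
  fields `E` embeddable in `F` (b24's `CorCM/Model/CMSliceOfWeilFaces.lean`, Shimura's type inflation + Mumford §19).

So, for ONE Galois CM field `K` with `6 ≤ [K:ℚ]`:

  (∀ face `f` of `K`, ∃ admissible `ι₁`, ∃ `V`, ∃ `σ`, `U_rec.PeriodNV ι₁ V K f.psi σ`)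
    ⟹ `HodgeConjectureFor A.dim A.X` for every `A` dominated by a product of CM abelian varieties with types of subfields of `K`

with NO other hypothesis (§3: the model data are the tree theorems `exists_isReal_hodgeModel_holds`,
`hodgePQ_independent_of_hodgeModel_holds`, `BallQuotient.ballQuotientUniformised_holds`, `cmAbelianVarietyRealised_holds`,
`deligneMilne1982_Thm_6_20_full_holds`).  This is the «FIELD CLOSURE» step of the degree-by-degree lane: once every face (or one
face per `Aut K × Aut K`-orbit, `CorCM/FaceSquareSymmetry.lean`) of a given `K` has a certified period witness, the named class
«abelian varieties dominated by products of CM abelian varieties with CM types of subfields of `K`» satisfies the Hodge conjecture,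
stated honestly for that `K` alone.  The face-local atom lets a closure MIX sources: faces settled by a period witness and faces
settled otherwise (e.g. the Weil-fourfold faces of a cyclic sextic field modulo Markman's theorem,
`CorCM/CyclicSexticHodgeRungOfMarkman.lean`) both land in the common currency `U_rec.WeilFaceAlgebraic K f`.

§4 is the same cut of the day-1 TRANSPOSITION socket: face-scoped theta data `U.FaceThetaDatum ι₁ V K f.psi ι₁`
(`CorCM/B01/ThetaRealisationSocket.lean`, engine `Universe.periodNV_of_faceThetaDatum`) for the faces of ONE field give the same
conclusions for that field (the global form with ALL fields is the lead's day-1 assembly `Model.hc_cm_closed_of_faceThetaDataExists`).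

Contents: §1 abstract universe (one face: `Universe.weilFaceAlgebraic_of_periodNV_admissible`,
`Universe.weilFaceAlgebraic_of_exists_periodNV` — no degree hypothesis; one field: `Universe.hc_cmProd_of_exists_periodNV_at`,
`Assembly.hc_cmProd_of_exists_periodNV_at`); §2 the model universe `Model.universeOf hHD hI hU h₃` modulo Riemann's theorem `hR`;
§3 CLOSED forms on the universe of record (headline `hodgeConjectureFor_of_avDominatedBy_isProductOf_of_exists_facePeriod_at`);
§4 socket forms over `FaceThetaDatum` (headline `hodgeConjectureFor_of_avDominatedBy_isProductOf_of_faceThetaData_at`).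

References: rfwf v3 Prop. 2.2 / Thm 1.3 / Lemma 8.2; H. Pohlmann, Ann. of Math. 88 (1968) Thm. 1; Y. André, Progr. Math. 102 (1992)
pp. 1–7; G. Shimura, *Abelian Varieties with Complex Multiplication and Modular Functions* (1998) §6.1–6.2; D. Mumford, *Abelian
Varieties* (1970) §19; P. Deligne, J. S. Milne, LNM 900 (1982) Thm. 6.20; J. S. Milne, *Hodge classes on abelian varieties* (2020) Thm. 1.
-/

noncomputable section

open CategoryTheory NumberField
open Literature.AlgebraicGeometry Literature.AlgebraicGeometry.Motives Literature.AlgebraicGeometry.HodgeTheory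
open Literature.AlgebraicGeometry.ComplexMultiplication Literature.AlgebraicGeometry.Milne1999
open Literature.NumberTheory.Automorphic
open Literature.NumberTheory.Automorphic.PicardCM

namespace Summit.HodgeConjecture.CorCM

/-! ## §1 Abstract universe: one face, one field -/

namespace Universe

variable {U : Universe}

/-- **One face, admissible eigen-embedding** (the surface criterion rfwf Prop. 2.2 read per face): a non-zero period of the face
`f` of a Galois CM field `F` on some compact Picard modular surface `P_Γ(V)` (`V` a hermitian 3-space at an ADMISSIBLE place `ι₁`,
eigenforms at `ι₁` itself) makes the Weil line `W_F(P(f))` algebraic.  No degree hypothesis, no other face involved. -/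
theorem weilFaceAlgebraic_of_periodNV_admissible (h22 : U.SurfaceCriterion) (hdim : U.PmsDimTwo) {F : CMField}
    (hG : IsGalois ℚ F) (f : Face F) {ι₁ : F →+* ℂ} (hι : f.Admissible ι₁) {V : HermSpace3 F ι₁}
    (h : U.PeriodNV ι₁ V F f.psi ι₁) : U.WeilFaceAlgebraic F f := by
  obtain ⟨Γ, Fm, α, hα, hper⟩ := h
  exact h22 F hG f ι₁ hι (U.pms F ι₁ V Γ) (hdim F ι₁ V Γ) Fm α hα hper

/-- **FACE-LOCAL ATOM.**  On a universe with one-dimensional CM eigenlines (`Fact_eigenLine`), the CM-type condition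
(`Fact_alphaLine`), the surface criterion rfwf Prop. 2.2 and `dim P_Γ = 2`: ONE period witness for ONE face `f` of a Galois CM
field `F` — some admissible `ι₁`, some hermitian 3-space `V`, some level, eigenforms at SOME embedding `σ` — implies that the Weil
line `W_F(P(f)) ⊂ H⁴(∏_{i<4} A_{(F,ψ_i(f))}, ℚ)` consists of algebraic classes.  (Transport `σ ↦ ι₁`, b07's
`periodNV_of_periodNV_of_forall_mem`, then `weilFaceAlgebraic_of_periodNV_admissible`.)  The per-face form of
`Universe.w_rk4_of_exists_periodNV`. [cite: Shimura1998, §6.2 Theorem 3 (pp. 41–43)] -/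
theorem weilFaceAlgebraic_of_exists_periodNV (hE : U.Fact_eigenLine) (hA : U.Fact_alphaLine) (h22 : U.SurfaceCriterion)
    (hdim : U.PmsDimTwo) {F : CMField} (hG : IsGalois ℚ F) (f : Face F)
    (h : ∃ ι₁ : F →+* ℂ, f.Admissible ι₁ ∧ ∃ (V : HermSpace3 F ι₁) (σ : F →+* ℂ), U.PeriodNV ι₁ V F f.psi σ) :
    U.WeilFaceAlgebraic F f := by
  obtain ⟨ι₁, hι, V, σ, hσ⟩ := h
  exact weilFaceAlgebraic_of_periodNV_admissible h22 hdim hG f hι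
    (periodNV_of_periodNV_of_forall_mem hE hA (admissible_mem_psi f ι₁ hι) hσ)

/-- **FIELD-LOCAL SCHEMA (abstract).**  With `FaceReduction` (Pohlmann + [QW8] Thm 2.5) in addition: for ONE Galois CM field `F`
with `6 ≤ [F:ℚ]`, one period witness per face of `F` implies `U.HC (∏_j A_{(F,Θ_j)})` — the Hodge conjecture of the universe, in
every codimension — for every finite family `Θ` of CM types of `F`.  The degree-local cut of `Assembly.hc_cm_of` ∘
`w_rk4_of_exists_periodNV` (everything but rfwf Lemma 8.2). [cite: Pohlmann1968, Thm. 1] [cite: Andre1992HodgeCM, Théorème (pp. 4–5)] -/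
theorem hc_cmProd_of_exists_periodNV_at (hE : U.Fact_eigenLine) (hA : U.Fact_alphaLine) (h22 : U.SurfaceCriterion)
    (hdim : U.PmsDimTwo) (hFR : U.FaceReduction) {F : CMField} (hG : IsGalois ℚ F) (h6 : 6 ≤ Module.finrank ℚ F)
    (h : ∀ f : Face F, ∃ ι₁ : F →+* ℂ, f.Admissible ι₁ ∧ ∃ (V : HermSpace3 F ι₁) (σ : F →+* ℂ), U.PeriodNV ι₁ V F f.psi σ)
    {n : ℕ} (Θ : Fin (n + 1) → CMType F) : U.HC (U.cmProd F Θ) :=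
  hFR F hG h6 (fun f => weilFaceAlgebraic_of_exists_periodNV hE hA h22 hdim hG f (h f)) n Θ

/-- The mixed-source form of the field-local schema: it is enough that every face of `F` is EITHER algebraic already OR carries a
period witness. -/
theorem hc_cmProd_of_weilFaceAlgebraic_or_exists_periodNV_at (hE : U.Fact_eigenLine) (hA : U.Fact_alphaLine)
    (h22 : U.SurfaceCriterion) (hdim : U.PmsDimTwo) (hFR : U.FaceReduction) {F : CMField} (hG : IsGalois ℚ F)
    (h6 : 6 ≤ Module.finrank ℚ F)
    (h : ∀ f : Face F, U.WeilFaceAlgebraic F f ∨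
      ∃ ι₁ : F →+* ℂ, f.Admissible ι₁ ∧ ∃ (V : HermSpace3 F ι₁) (σ : F →+* ℂ), U.PeriodNV ι₁ V F f.psi σ)
    {n : ℕ} (Θ : Fin (n + 1) → CMType F) : U.HC (U.cmProd F Θ) :=
  hFR F hG h6 (fun f => (h f).elim id (weilFaceAlgebraic_of_exists_periodNV hE hA h22 hdim hG f)) n Θ

end Universe

namespace Assembly

open Universe StubTree

variable (U : Universe)

/-- **Field-local schema with the textbook facts spelled out** (the pattern of `Assembly.hc_cm_of_exists_periodNV`, stopping
before rfwf Lemma 8.2): for a universe with the 28 model facts `ModelAxioms` and N1–N4, F2, F4–F7, one period witness per face of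
ONE Galois CM field `F` with `6 ≤ [F:ℚ]` implies `U.HC (∏_j A_{(F,Θ_j)})` for every family `Θ` of CM types of `F`.
[cite: Pohlmann1968, Thm. 1] [cite: Andre1992HodgeCM, Théorème (pp. 4–5)] -/
theorem hc_cmProd_of_exists_periodNV_at (M : U.ModelAxioms) {F : CMField} (hG : IsGalois ℚ F)
    (hdeg : 6 ≤ Module.finrank ℚ F)
    (h : ∀ f : Face F, ∃ ι₁ : F →+* ℂ, f.Admissible ι₁ ∧ ∃ (V : HermSpace3 F ι₁) (σ : F →+* ℂ), U.PeriodNV ι₁ V F f.psi σ)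
    (hN1 : U.Fact_cupExterior) (hN2 : U.Fact_cup_hodge) (hN3 : U.Fact_pull_H0) (hN4 : U.Fact_hodge_F0)
    (h2 : U.Fact_factorActDescends) (h4 : U.Fact_cupAlg) (h5 : U.Fact_cupAssoc) (h6 : U.Fact_weightDual)
    (h7 : U.Fact_gysin) {n : ℕ} (Θ : Fin (n + 1) → CMType F) : U.HC (U.cmProd F Θ) :=
  Universe.hc_cmProd_of_exists_periodNV_at M.eigenLine M.alphaLine (Universe.surfaceCriterion_holds M) M.pms_dim
    (faceReduction_holds U (U.pohlmannSpan_of_facts M hN1 hN2 hN3 hN4)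
      (U.qw8Sufficiency_of_geometricFacts M hN1 hN2 hN3 hN4 h2 h4 h5 h6 h7)) hG hdeg h Θ

end Assembly

/-! ## §2 The model universe `Model.universeOf hHD hI hU h₃`, modulo Riemann's theorem -/

namespace Model

open Summit.HodgeConjecture.CorCM.Domination

/-- **One face, on the model** (rows M13 `Fact_eigenLine`, M14 `Fact_alphaLine`, M04 `pms_dim` and the surface criterion are tree
theorems of the model; the `ModelAxioms` record feeding `Universe.surfaceCriterion_holds` is assembled modulo Riemann's theorem
`hR`, Deligne–Milne 1982 Thm 6.20, as in `Model.hc_cm_of_rows`): a period witness for the face `f` of the Galois CM field `F` makes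
`W_F(P(f))` algebraic on `Model.universeOf hHD hI hU h₃`. [cite: DeligneMilne1982Tannakian, §6 Thm. 6.20 (Riemann), p. 212]
[cite: Shimura1998, §6.2 Theorem 3 (pp. 41–43)] -/
theorem universeOf_weilFaceAlgebraic_of_exists_periodNV
    (hHD : exists_isReal_hodgeModel) (hI : hodgePQ_independent_of_hodgeModel) (hU : BallQuotientUniformisedDatum)
    (h₃ : CMAbelianVarietyRealised) (hR : DeligneMilne1982_Thm_6_20_full) {F : CMField}
    (hG : IsGalois ℚ F) (f : Face F)
    (h : ∃ ι₁ : F →+* ℂ, f.Admissible ι₁ ∧ ∃ (V : HermSpace3 F ι₁) (σ : F →+* ℂ),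
      (universeOf hHD hI hU h₃).PeriodNV ι₁ V F f.psi σ) :
    (universeOf hHD hI hU h₃).WeilFaceAlgebraic F f :=
  Universe.weilFaceAlgebraic_of_exists_periodNV (universeOf_fact_eigenLine hHD hI hU h₃)
    (universeOf_fact_alphaLine hHD hI hU h₃)
    (Universe.surfaceCriterion_holds (modelAxioms_of_rows hHD hI hU h₃ hR (universeOf_algDuality hHD hI hU h₃)))
    (universeOf_pmsDimTwo hHD hI hU h₃) hG f h

/-- **One field, on the model**: `U.HC (∏_j A_{(F,Θ_j)})` for every family `Θ` of CM types of ONE Galois CM field `F` with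
`6 ≤ [F:ℚ]`, from one period witness per face of `F` (b07's rung `hc_cmProd_of_weilFaceAlgebraic_of_riemann` fed face by face),
modulo `hR`. [cite: Pohlmann1968, Thm. 1] [cite: Milne2020HodgeClassesAV, Theorem 1] -/
theorem universeOf_hc_cmProd_of_exists_periodNV_at
    (hHD : exists_isReal_hodgeModel) (hI : hodgePQ_independent_of_hodgeModel) (hU : BallQuotientUniformisedDatum)
    (h₃ : CMAbelianVarietyRealised) (hR : DeligneMilne1982_Thm_6_20_full) {F : CMField} (hG : IsGalois ℚ F)
    (h6 : 6 ≤ Module.finrank ℚ F)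
    (h : ∀ f : Face F, ∃ ι₁ : F →+* ℂ, f.Admissible ι₁ ∧ ∃ (V : HermSpace3 F ι₁) (σ : F →+* ℂ),
      (universeOf hHD hI hU h₃).PeriodNV ι₁ V F f.psi σ)
    {n : ℕ} (Θ : Fin (n + 1) → CMType F) :
    (universeOf hHD hI hU h₃).HC ((universeOf hHD hI hU h₃).cmProd F Θ) :=
  hc_cmProd_of_weilFaceAlgebraic_of_riemann hHD hI hU h₃ F hR hG h6
    (fun f => universeOf_weilFaceAlgebraic_of_exists_periodNV hHD hI hU h₃ hR hG f (h f)) Θ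

/-- **On the tree's abelian variety `∏_j A_{(F,Θ_j)}`** (`Domination.cmProdAV F h₃ n Θ`, whose underlying scheme interprets
`U.cmProd F Θ`): the Hodge conjecture in every codimension, from one period witness per face of `F`, modulo `hR` and relative to the
model data. [cite: Andre1992HodgeCM, Théorème (pp. 4–5)] [cite: Milne2020HodgeClassesAV, Theorem 1] -/
theorem hodgeConjectureFor_cmProdAV_of_exists_periodNV_at
    (hHD : exists_isReal_hodgeModel) (hI : hodgePQ_independent_of_hodgeModel) (hU : BallQuotientUniformisedDatum)
    (h₃ : CMAbelianVarietyRealised) (hR : DeligneMilne1982_Thm_6_20_full) {F : CMField}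
    (hG : IsGalois ℚ F) (h6 : 6 ≤ Module.finrank ℚ F)
    (h : ∀ f : Face F, ∃ ι₁ : F →+* ℂ, f.Admissible ι₁ ∧ ∃ (V : HermSpace3 F ι₁) (σ : F →+* ℂ),
      (universeOf hHD hI hU h₃).PeriodNV ι₁ V F f.psi σ)
    {n : ℕ} (Θ : Fin (n + 1) → CMType F) :
    HodgeConjectureFor (cmProdAV F h₃ n Θ).dim (cmProdAV F h₃ n Θ).X :=
  hodgeConjectureFor_cmProdAV_of_weilFaceAlgebraic_of_riemann hHD hI hU h₃ F hR hG h6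
    (fun f => universeOf_weilFaceAlgebraic_of_exists_periodNV hHD hI hU h₃ hR hG f (h f)) Θ

/-- **… and for every complex abelian variety dominated by `∏_j A_{(F,Θ_j)}`** (`AVDominatedBy A P`: `s ≫ π = [N]_A`, `N ≠ 0`;
Mumford §19), modulo `hR` and the model data. [cite: MumfordAV1970, §19 Thm. 1 and p. 169] [cite: Milne2020HodgeClassesAV, Theorem 1] -/
theorem hodgeConjectureFor_of_avDominatedBy_cmProdAV_of_exists_periodNV_at
    (hHD : exists_isReal_hodgeModel) (hI : hodgePQ_independent_of_hodgeModel) (hU : BallQuotientUniformisedDatum)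
    (h₃ : CMAbelianVarietyRealised) (hR : DeligneMilne1982_Thm_6_20_full)
    {F : CMField} (hG : IsGalois ℚ F) (h6 : 6 ≤ Module.finrank ℚ F)
    (h : ∀ f : Face F, ∃ ι₁ : F →+* ℂ, f.Admissible ι₁ ∧ ∃ (V : HermSpace3 F ι₁) (σ : F →+* ℂ),
      (universeOf hHD hI hU h₃).PeriodNV ι₁ V F f.psi σ)
    (A : AbelianVariety ℂ) {n : ℕ} {Θ : Fin (n + 1) → CMType F} (hdom : AVDominatedBy A (cmProdAV F h₃ n Θ)) :
    HodgeConjectureFor A.dim A.X :=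
  hodgeConjectureFor_of_avDominatedBy_cmProdAV_of_weilFaceAlgebraic_of_riemann hHD hI hU h₃ F hR hG h6
    (fun f => universeOf_weilFaceAlgebraic_of_exists_periodNV hHD hI hU h₃ hR hG f (h f)) A hdom

/-- **The `F`-generated CM slice, on the model**: for ONE Galois CM field `F` with `6 ≤ [F:ℚ]` and one period witness per face of
`F`, every complex abelian variety `A` dominated by a finite product `P` (`AbelianVariety.IsProductOf`) of abelian varieties each
realising on `H¹` a CM type of a CM field `E` with an embedding `E →+* F` satisfies the Hodge conjecture in every codimension —
modulo `hR` and the model data (b24's `hodgeConjectureFor_of_avDominatedBy_isProductOf_of_weilFaceAlgebraic_of_riemann`).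
[cite: Shimura1998, §6.2 Theorem 3 and §6.1 Corollary of Theorem 2 (pp. 41–43)] [cite: MumfordAV1970, §19 Thm. 1 and p. 169] -/
theorem hodgeConjectureFor_of_avDominatedBy_isProductOf_of_exists_periodNV_at
    (hHD : exists_isReal_hodgeModel) (hI : hodgePQ_independent_of_hodgeModel) (hU : BallQuotientUniformisedDatum)
    (h₃ : CMAbelianVarietyRealised) (hR : DeligneMilne1982_Thm_6_20_full)
    {F : CMField} (hG : IsGalois ℚ F) (h6 : 6 ≤ Module.finrank ℚ F)
    (h : ∀ f : Face F, ∃ ι₁ : F →+* ℂ, f.Admissible ι₁ ∧ ∃ (V : HermSpace3 F ι₁) (σ : F →+* ℂ),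
      (universeOf hHD hI hU h₃).PeriodNV ι₁ V F f.psi σ)
    {P A : AbelianVariety ℂ} (hP : AbelianVariety.IsProductOf (fun B : AbelianVariety ℂ =>
      ∃ (E : Type) (_ : Field E) (_ : NumberField E) (_ : IsCMField E) (_ : E →+* (F : Type)) (Φ : CMType E)
        (ι : 𝓞 E →+* End B) (θ : E →+* Module.End ℂ (complexBetti B.X 1)),
        IsCMTypeRealisation Φ B ι θ) P)
    (hA : AVDominatedBy A P) : HodgeConjectureFor A.dim A.X :=
  hodgeConjectureFor_of_avDominatedBy_isProductOf_of_weilFaceAlgebraic_of_riemann hHD hI hU h₃ F hR hG h6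
    (fun f => universeOf_weilFaceAlgebraic_of_exists_periodNV hHD hI hU h₃ hR hG f (h f)) hP hA

end Model

/-! ## §3 CLOSED forms on the universe of record (model data = tree theorems) -/

open Summit.HodgeConjecture.CorCM.Domination

/-- **FACE-LOCAL ATOM on the universe of record.**  For a Galois CM field `F` and ONE face `f` of `F`: a period witness on the
Picard–CM model universe of record (at the tree theorems `exists_isReal_hodgeModel_holds`, `hodgePQ_independent_of_hodgeModel_holds`,
`BallQuotient.ballQuotientUniformised_holds`, `cmAbelianVarietyRealised_holds`; Riemann's theorem by
`deligneMilne1982_Thm_6_20_full_holds`) makes the Weil line `W_F(P(f))` algebraic there.  No degree hypothesis.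
[cite: Shimura1998, §6.2 Theorem 3 (pp. 41–43)] [cite: DeligneMilne1982Tannakian, §6 Thm. 6.20 (Riemann), p. 212] -/
theorem weilFaceAlgebraic_of_exists_facePeriod {F : CMField} (hG : IsGalois ℚ F) (f : Face F)
    (h : ∃ ι₁ : F →+* ℂ, f.Admissible ι₁ ∧ ∃ (V : HermSpace3 F ι₁) (σ : F →+* ℂ),
      (Model.picardCMUniverse exists_isReal_hodgeModel_holds hodgePQ_independent_of_hodgeModel_holds
        BallQuotient.ballQuotientUniformised_holds cmAbelianVarietyRealised_holds).PeriodNV ι₁ V F f.psi σ) :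
    (Model.picardCMUniverse exists_isReal_hodgeModel_holds hodgePQ_independent_of_hodgeModel_holds
      BallQuotient.ballQuotientUniformised_holds cmAbelianVarietyRealised_holds).WeilFaceAlgebraic F f :=
  Model.universeOf_weilFaceAlgebraic_of_exists_periodNV _ _ _ _ deligneMilne1982_Thm_6_20_full_holds hG f h

/-- **`HodgeConjectureFor (∏_j A_{(K,Θ_j)})` from the face periods of `K` alone.**  For ONE Galois CM field `K` with `6 ≤ [K:ℚ]`:
one period witness per face of `K` on the universe of record ⟹ the Hodge conjecture, in every codimension, for the product
`Domination.cmProdAV K _ n Θ` of the chosen realisations of any finite family `Θ` of CM types of `K`.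
[cite: Pohlmann1968, Thm. 1] [cite: Andre1992HodgeCM, Théorème (pp. 4–5)] -/
theorem hodgeConjectureFor_cmProdAV_of_exists_facePeriod_at (K : CMField) [hG : IsGalois ℚ K]
    (h6 : 6 ≤ Module.finrank ℚ K)
    (h : ∀ f : Face K, ∃ ι₁ : K →+* ℂ, f.Admissible ι₁ ∧ ∃ (V : HermSpace3 K ι₁) (σ : K →+* ℂ),
      (Model.picardCMUniverse exists_isReal_hodgeModel_holds hodgePQ_independent_of_hodgeModel_holds
        BallQuotient.ballQuotientUniformised_holds cmAbelianVarietyRealised_holds).PeriodNV ι₁ V K f.psi σ)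
    {n : ℕ} (Θ : Fin (n + 1) → CMType K) :
    HodgeConjectureFor (cmProdAV K cmAbelianVarietyRealised_holds n Θ).dim
      (cmProdAV K cmAbelianVarietyRealised_holds n Θ).X :=
  Model.hodgeConjectureFor_cmProdAV_of_exists_periodNV_at _ _ _ _ deligneMilne1982_Thm_6_20_full_holds hG h6 h Θ

/-- **… and for every complex abelian variety dominated by `∏_j A_{(K,Θ_j)}`**, from the face periods of `K` alone.
[cite: MumfordAV1970, §19 Thm. 1 and p. 169] [cite: Milne2020HodgeClassesAV, Theorem 1] -/
theorem hodgeConjectureFor_of_avDominatedBy_cmProdAV_of_exists_facePeriod_at (K : CMField) [hG : IsGalois ℚ K]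
    (h6 : 6 ≤ Module.finrank ℚ K)
    (h : ∀ f : Face K, ∃ ι₁ : K →+* ℂ, f.Admissible ι₁ ∧ ∃ (V : HermSpace3 K ι₁) (σ : K →+* ℂ),
      (Model.picardCMUniverse exists_isReal_hodgeModel_holds hodgePQ_independent_of_hodgeModel_holds
        BallQuotient.ballQuotientUniformised_holds cmAbelianVarietyRealised_holds).PeriodNV ι₁ V K f.psi σ)
    (A : AbelianVariety ℂ) {n : ℕ} {Θ : Fin (n + 1) → CMType K}
    (hdom : AVDominatedBy A (cmProdAV K cmAbelianVarietyRealised_holds n Θ)) : HodgeConjectureFor A.dim A.X :=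
  Model.hodgeConjectureFor_of_avDominatedBy_cmProdAV_of_exists_periodNV_at _ _ _ _ deligneMilne1982_Thm_6_20_full_holds
    hG h6 h A hdom

/-- **INT-2, CLOSED — the `K`-generated CM slice of the Hodge conjecture from the face periods of `K`.**  Let `K` be ONE Galois CM
field with `6 ≤ [K:ℚ]` such that every rank-four face `f` of `K` has a period witness on the universe of record (some admissible
`ι₁`, some hermitian 3-space `V`, some level, eigenforms at some `σ`).  Then every complex abelian variety `A` dominated by a finite
product of abelian varieties each realising a CM type of a CM field `E` with `E →+* K` — every `A` isogenous to
`∏_i A_{(E_i,Φ_i)}^{n_i}` with all `E_i ⊆ K`, e.g. `B^a × E^b` for a CM abelian variety `B` of a type of `K` and a CM elliptic curve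
`E` of an imaginary quadratic subfield — satisfies `HodgeConjectureFor A.dim A.X`, in every codimension.  NO other hypothesis.
(FRAMING: a statement about the abelian varieties generated by ONE field `K`, conditional on `K`'s face periods; `HC_CM` is not
proved.) [cite: Shimura1998, §6.2 Theorem 3 and §6.1 Corollary of Theorem 2 (pp. 41–43)] [cite: Pohlmann1968, Thm. 1]
[cite: Andre1992HodgeCM, Théorème (pp. 4–5)] [cite: MumfordAV1970, §19 Thm. 1 and p. 169] -/
theorem hodgeConjectureFor_of_avDominatedBy_isProductOf_of_exists_facePeriod_at (K : CMField) [hG : IsGalois ℚ K]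
    (h6 : 6 ≤ Module.finrank ℚ K)
    (h : ∀ f : Face K, ∃ ι₁ : K →+* ℂ, f.Admissible ι₁ ∧ ∃ (V : HermSpace3 K ι₁) (σ : K →+* ℂ),
      (Model.picardCMUniverse exists_isReal_hodgeModel_holds hodgePQ_independent_of_hodgeModel_holds
        BallQuotient.ballQuotientUniformised_holds cmAbelianVarietyRealised_holds).PeriodNV ι₁ V K f.psi σ)
    {P A : AbelianVariety ℂ} (hP : AbelianVariety.IsProductOf (fun B : AbelianVariety ℂ =>
      ∃ (E : Type) (_ : Field E) (_ : NumberField E) (_ : IsCMField E) (_ : E →+* (K : Type)) (Φ : CMType E)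
        (ι : 𝓞 E →+* End B) (θ : E →+* Module.End ℂ (complexBetti B.X 1)),
        IsCMTypeRealisation Φ B ι θ) P)
    (hA : AVDominatedBy A P) : HodgeConjectureFor A.dim A.X :=
  Model.hodgeConjectureFor_of_avDominatedBy_isProductOf_of_exists_periodNV_at _ _ _ _ deligneMilne1982_Thm_6_20_full_holds
    hG h6 h hP hA

/-- **Isogeny reading** of the closed slice: every abelian variety isogenous to such a product `P` (and `P` itself).
[cite: MumfordAV1970, §19 Thm. 1 and p. 169] -/
theorem hodgeConjectureFor_of_isIsogenous_isProductOf_of_exists_facePeriod_at (K : CMField) [IsGalois ℚ K]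
    (h6 : 6 ≤ Module.finrank ℚ K)
    (h : ∀ f : Face K, ∃ ι₁ : K →+* ℂ, f.Admissible ι₁ ∧ ∃ (V : HermSpace3 K ι₁) (σ : K →+* ℂ),
      (Model.picardCMUniverse exists_isReal_hodgeModel_holds hodgePQ_independent_of_hodgeModel_holds
        BallQuotient.ballQuotientUniformised_holds cmAbelianVarietyRealised_holds).PeriodNV ι₁ V K f.psi σ)
    {P A : AbelianVariety ℂ} (hP : AbelianVariety.IsProductOf (fun B : AbelianVariety ℂ =>
      ∃ (E : Type) (_ : Field E) (_ : NumberField E) (_ : IsCMField E) (_ : E →+* (K : Type)) (Φ : CMType E)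
        (ι : 𝓞 E →+* End B) (θ : E →+* Module.End ℂ (complexBetti B.X 1)),
        IsCMTypeRealisation Φ B ι θ) P)
    (hA : AbelianVariety.IsIsogenous A P) : HodgeConjectureFor A.dim A.X :=
  hodgeConjectureFor_of_avDominatedBy_isProductOf_of_exists_facePeriod_at K h6 h hP
    (AVDominatedBy.of_isIsogenous hA (AVDominatedBy.refl P))

/-- **Headline `B^{a+1} × E^{b+1}`** of the closed slice: `B` realising a CM type `Ψ` of `K`, `E` realising a CM type of a CM field
`E₀` with `k : E₀ →+* K`; every abelian variety dominated by `B^{a+1} × E^{b+1}` satisfies the Hodge conjecture — from the face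
periods of `K` alone. [cite: Shimura1998, §6.2 Theorem 3 and §6.1 Corollary of Theorem 2 (pp. 41–43)] [cite: Milne2020HodgeClassesAV, Theorem 1] -/
theorem hodgeConjectureFor_of_avDominatedBy_powSucc_prod_powSucc_of_exists_facePeriod_at (K : CMField) [hG : IsGalois ℚ K]
    (h6 : 6 ≤ Module.finrank ℚ K)
    (h : ∀ f : Face K, ∃ ι₁ : K →+* ℂ, f.Admissible ι₁ ∧ ∃ (V : HermSpace3 K ι₁) (σ : K →+* ℂ),
      (Model.picardCMUniverse exists_isReal_hodgeModel_holds hodgePQ_independent_of_hodgeModel_holds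
        BallQuotient.ballQuotientUniformised_holds cmAbelianVarietyRealised_holds).PeriodNV ι₁ V K f.psi σ)
    {Ψ : CMType K} {B : AbelianVariety ℂ} {ιB : 𝓞 K →+* End B}
    {θB : (K : Type) →+* Module.End ℂ (complexBetti B.X 1)} (hB : IsCMTypeRealisation Ψ B ιB θB)
    {E₀ : Type} [Field E₀] [NumberField E₀] [IsCMField E₀] (k : E₀ →+* (K : Type)) {Φ₀ : CMType E₀}
    {E : AbelianVariety ℂ} {ιE : 𝓞 E₀ →+* End E} {θE : E₀ →+* Module.End ℂ (complexBetti E.X 1)}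
    (hE : IsCMTypeRealisation Φ₀ E ιE θE) (a b : ℕ) {A : AbelianVariety ℂ}
    (hA : AVDominatedBy A ((B.powSucc a).prod (E.powSucc b))) : HodgeConjectureFor A.dim A.X :=
  hodgeConjectureFor_of_avDominatedBy_powSucc_prod_powSucc_of_weilFaceAlgebraic K
    BallQuotient.ballQuotientUniformised_holds hG h6
    (fun f => weilFaceAlgebraic_of_exists_facePeriod hG f (h f)) hB k hE a b hA

/-! ## §4 Socket forms: face-scoped theta data for the faces of ONE field -/

namespace Model

/-- **One face, socket form, on the model**: face-scoped theta-realisation data `FaceThetaDatum ι₁ V F f.psi ι₁`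
(`CorCM/B01/ThetaRealisationSocket.lean`) at some admissible `ι₁` and some `V` run through the engine
`Universe.periodNV_of_faceThetaDatum` (rows M01 `pull_comp`, M03 `pull_hodge`, `cup2_hodge`, M02 `pull_cup` of the model) and then
through `universeOf_weilFaceAlgebraic_of_exists_periodNV`: `W_F(P(f))` is algebraic, modulo `hR`.
[cite: Shimura1998, §6.2 Theorem 3 (pp. 41–43)] -/
theorem universeOf_weilFaceAlgebraic_of_faceThetaDatum
    (hHD : exists_isReal_hodgeModel) (hI : hodgePQ_independent_of_hodgeModel) (hU : BallQuotientUniformisedDatum)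
    (h₃ : CMAbelianVarietyRealised) (hR : DeligneMilne1982_Thm_6_20_full) {F : CMField}
    (hG : IsGalois ℚ F) (f : Face F)
    (h : ∃ ι₁ : F →+* ℂ, f.Admissible ι₁ ∧ ∃ V : HermSpace3 F ι₁,
      Nonempty ((universeOf hHD hI hU h₃).FaceThetaDatum ι₁ V F f.psi ι₁)) :
    (universeOf hHD hI hU h₃).WeilFaceAlgebraic F f := by
  obtain ⟨ι₁, hι, V, ⟨R⟩⟩ := h
  exact universeOf_weilFaceAlgebraic_of_exists_periodNV hHD hI hU h₃ hR hG f
    ⟨ι₁, hι, V, ι₁, Universe.periodNV_of_faceThetaDatum (universeOf_fact_pull_comp hHD hI hU h₃)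
      (universeOf_fact_pull_hodge hHD hI hU h₃) (universeOf_fact_cup2_hodge hHD hI hU h₃)
      (universeOf_fact_pull_cup hHD hI hU h₃) R⟩

end Model

/-- **One face, socket form, on the universe of record** (all model data = tree theorems).
[cite: Shimura1998, §6.2 Theorem 3 (pp. 41–43)] -/
theorem weilFaceAlgebraic_of_faceThetaDatum {F : CMField} (hG : IsGalois ℚ F) (f : Face F)
    (h : ∃ ι₁ : F →+* ℂ, f.Admissible ι₁ ∧ ∃ V : HermSpace3 F ι₁,
      Nonempty ((Model.picardCMUniverse exists_isReal_hodgeModel_holds hodgePQ_independent_of_hodgeModel_holds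
        BallQuotient.ballQuotientUniformised_holds cmAbelianVarietyRealised_holds).FaceThetaDatum ι₁ V F f.psi ι₁)) :
    (Model.picardCMUniverse exists_isReal_hodgeModel_holds hodgePQ_independent_of_hodgeModel_holds
      BallQuotient.ballQuotientUniformised_holds cmAbelianVarietyRealised_holds).WeilFaceAlgebraic F f :=
  Model.universeOf_weilFaceAlgebraic_of_faceThetaDatum _ _ _ _ deligneMilne1982_Thm_6_20_full_holds hG f h

/-- **INT-2 in socket form, CLOSED — the field-local cut of the day-1 transposition target.**  For ONE Galois CM field `K` with
`6 ≤ [K:ℚ]`: face-scoped theta data for every face of `K` on the universe of record (some admissible `ι₁`, some `V` per face)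
imply the Hodge conjecture for every complex abelian variety dominated by a finite product of realisations of CM types of CM
fields embeddable in `K`.  (The global form over ALL fields is the lead's `Model.hc_cm_closed_of_faceThetaDataExists`; `HC_CM` is
not proved.) [cite: Shimura1998, §6.2 Theorem 3 and §6.1 Corollary of Theorem 2 (pp. 41–43)] [cite: Pohlmann1968, Thm. 1]
[cite: MumfordAV1970, §19 Thm. 1 and p. 169] -/
theorem hodgeConjectureFor_of_avDominatedBy_isProductOf_of_faceThetaData_at (K : CMField) [hG : IsGalois ℚ K]
    (h6 : 6 ≤ Module.finrank ℚ K)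
    (h : ∀ f : Face K, ∃ ι₁ : K →+* ℂ, f.Admissible ι₁ ∧ ∃ V : HermSpace3 K ι₁,
      Nonempty ((Model.picardCMUniverse exists_isReal_hodgeModel_holds hodgePQ_independent_of_hodgeModel_holds
        BallQuotient.ballQuotientUniformised_holds cmAbelianVarietyRealised_holds).FaceThetaDatum ι₁ V K f.psi ι₁))
    {P A : AbelianVariety ℂ} (hP : AbelianVariety.IsProductOf (fun B : AbelianVariety ℂ =>
      ∃ (E : Type) (_ : Field E) (_ : NumberField E) (_ : IsCMField E) (_ : E →+* (K : Type)) (Φ : CMType E)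
        (ι : 𝓞 E →+* End B) (θ : E →+* Module.End ℂ (complexBetti B.X 1)),
        IsCMTypeRealisation Φ B ι θ) P)
    (hA : AVDominatedBy A P) : HodgeConjectureFor A.dim A.X :=
  hodgeConjectureFor_of_avDominatedBy_isProductOf_of_weilFaceAlgebraic K BallQuotient.ballQuotientUniformised_holds hG h6
    (fun f => weilFaceAlgebraic_of_faceThetaDatum hG f (h f)) hP hA

end Summit.HodgeConjecture.CorCM

end
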